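/-
Copyright (c) 2026 the pub-hodgecm2 formalisation cell (harness21).  New file, not vendored.
Origin: (c-S.1) RE-KEY error wave ∕ Track T input, pair «subcorner» seat «a» (prover-pub-hodgecm2-rekey-l1-subcorner-a-g0-0), 2026-08-23.
KERNEL ONLY: theorems; no definition, nothing cited anew; imports LIVE modules only (`HodgeCM.Model.LiuCMSideSubCorner`, `HodgeCM.Model.LiuCMSideOfReflex`,
✔ `CorCM.D2Bridge.OrientationReflexConj`).
HELD; HC_CM is NOT proved; NOT «Δ2 BRIDGE CLOSED».
-/
import Summits.HodgeConjecture.HodgeCM.Model.LiuCMSideSubCorner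
import Summits.HodgeConjecture.HodgeCM.Model.LiuCMSideOfReflex
import Summits.HodgeConjecture.CorCM.D2Bridge.OrientationReflexConj
import HarnessLib

set_option autoImplicit false

/-!
Re-key (c-S.1) ∕ Track T seam lemmas for the SUB-CORNER predicate — HELD; HC_CM is NOT proved.

# Which corners an admissible record can serve: `IsSubCorner` under conjugation, and the orientation constraint

`C.IsSubCorner K Ψ σ` (own-htheta #H14, `Model/LiuCMSideSubCorner.lean` :61) says that the corner type `Ψ` of `K` and the record's realised type
`C.ΦA` are inflated from ONE CM pair `(M', Φ')` along `e₁ : M' → K`, `e₂ : M' → C.M`, with `σ ∘ e₁ = C.τ ∘ e₂`.  Two kernel facts: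

* `isSubCorner_bar_iff_conjugate` — **`C.IsSubCorner K Ψ̄ σ ↔ C.IsSubCorner K Ψ σ̄`** (re-parametrise `e₁` by the complex conjugation of
  the CM field `M'`): conjugating the corner TYPE is the same as conjugating the corner EMBEDDING.
* `isSubCorner_bar_conjugate_iff` — **`C.IsSubCorner K Ψ̄ σ̄ ↔ C.IsSubCorner K Ψ σ`**: conjugating BOTH corner labels changes nothing (so a
  conjugate-labelled context `c̄` serves the same records as `c`).
* `mem_iff_tau_mem_of_isSubCorner` — **along any sub-corner, `σ ∈ Ψ ↔ C.τ ∈ C.ΦA`**: the corner embedding lies in the corner type iff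
  the record's eigen-embedding lies in its realised CM type (both read the common embedding `σ ∘ e₁ = τ ∘ e₂` of `M'` against `Φ'`).

Consequences with own-crow's orientation lemmas K2∕K3 (✔ `D2Bridge/OrientationReflexConj.lean`), `L/ℚ` Galois, at a line type `Φ` with `ι₁ ∈ Φ`
(a `PhiMu` line of the dictionary of record):
* `mem_of_isSubCorner_of_isReflexOfTypeG` — an `ι₁`-ADMISSIBLE record (`adm`) is a sub-corner only of corners with **`σ ∈ Ψ`**;
* `not_mem_of_isSubCorner_of_isReflexOfTypeG_starRingEnd_comp` — an `ῑ₁`-ADMISSIBLE record (the primed `adm′`) is a sub-corner only of corners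
  with **`σ ∉ Ψ`**.  In particular it is NEVER a sub-corner of the served corner `(c.K, c.Ψ i, c.σ)` (`GoodCtx.mem : c.σ ∈ c.Ψ i`), NOR of the
  fully conjugated corner `(c.K, bar (c.Ψ i), conj ∘ c.σ)` (where again `σ̄ ∈ Ψ̄`); the corners it does serve are `(K, Ψ̄ᵢ, σ)` ≡ `(K, Ψᵢ, σ̄)`
  (`isSubCorner_bar_iff_conjugate`), at which r8's `Uiso`-inclusion (`span_classes_le_Uiso … (hσ : σ ∈ Ψ.1)`) has no `hσ`.
* `not_forall_isReflexOfTypeG_starRingEnd_comp_isSubCorner(_bar_conjugate)` — REFUTATION of the primed junction's clause 2 at a served `PhiMu`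
  slot, for the context `c` and for its relabelling `c̄` (non-vacuity witness: `LiuCMSide.ofReflex ῑ₁ hCM Φ`).
This is the corner-level form of the Hodge-type obstruction (ORIENTATION-MEMO §8): `adm′`-records carry `(0,1)`-classes and no `U_iso(Γ, K, Ψ, σ)` piece
with `σ ∈ Ψ` receives them.

KIND: kernel, 0 proof holes; expected `#print axioms` ⊆ {propext, Classical.choice, Quot.sound}.
-/

noncomputable section

open NumberField NumberField.ComplexEmbedding
open scoped ComplexConjugate
open Literature.AlgebraicGeometry.Motives (CMType)
open Literature.AlgebraicGeometry.ShimuraVarieties (conjRingHomK embedding_conjRingHomK)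
open HodgeCM
open HodgeCM.CMTypeOps (bar mem_bar_iff conjugate_mem_iff_notMem)

namespace HodgeCM.Model.Rekey

/-! ## §1 `IsSubCorner` under conjugation of the corner -/

/-- A ring homomorphism of CM fields intertwines the complex conjugations (read through any complex embedding of the target). [folklore] -/
theorem ringHom_map_conjRingHomK {M' K : CMField} (e : (M' : Type) →+* K) (x : M') : e (conjRingHomK M' x) = conjRingHomK K (e x) := by
  obtain ⟨ι⟩ := (inferInstance : Nonempty ((K : Type) →+* ℂ))
  apply ι.injective
  have h1 := embedding_conjRingHomK M' (ι.comp e) x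
  simp only [RingHom.coe_comp, Function.comp_apply] at h1
  rw [h1, embedding_conjRingHomK]

/-- `τ ∘ (e₁ ∘ c_{M'}) = conj ∘ (τ ∘ e₁)`. [folklore] -/
theorem comp_comp_conjRingHomK_eq_conjugate {M' K : CMField} (τ : (K : Type) →+* ℂ) (e₁ : (M' : Type) →+* K) :
    τ.comp (e₁.comp (conjRingHomK M')) = conjugate (τ.comp e₁) := by
  ext x
  rw [conjugate_coe_eq, RingHom.comp_apply, RingHom.comp_apply, RingHom.comp_apply, ringHom_map_conjRingHomK, embedding_conjRingHomK]

/-- One direction of the symmetry: a sub-corner of `(K, Ψ̄, σ)` is a sub-corner of `(K, Ψ, σ̄)` — same common pair `(M', Φ')` and `e₂`, with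
`e₁` re-parametrised by the complex conjugation of `M'`. [folklore] -/
theorem isSubCorner_conjugate_of_isSubCorner_bar (C : LiuCMSide) {K : CMField} {Ψ : CMType K} {σ : (K : Type) →+* ℂ}
    (h : C.IsSubCorner K (bar Ψ) σ) : C.IsSubCorner K Ψ (conjugate σ) := by
  obtain ⟨M', Φ', e₁, e₂, hΨ, hΦA, hστ⟩ := h
  refine ⟨M', Φ', e₁.comp (conjRingHomK M'), e₂, fun τ => ?_, hΦA, ?_⟩
  · rw [comp_comp_conjRingHomK_eq_conjugate, conjugate_mem_iff_notMem Φ' (τ.comp e₁), ← hΨ τ, mem_bar_iff, not_not]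
  · rw [← hστ, comp_comp_conjRingHomK_eq_conjugate]
    exact RingHom.ext fun x => starRingEnd_self_apply (σ (e₁ x))

/-- **`C.IsSubCorner K Ψ̄ σ ↔ C.IsSubCorner K Ψ σ̄`**: conjugating the corner type = conjugating the corner embedding. [folklore] -/
theorem isSubCorner_bar_iff_conjugate (C : LiuCMSide) {K : CMField} (Ψ : CMType K) (σ : (K : Type) →+* ℂ) :
    C.IsSubCorner K (bar Ψ) σ ↔ C.IsSubCorner K Ψ (conjugate σ) := by
  refine ⟨isSubCorner_conjugate_of_isSubCorner_bar C, fun h => ?_⟩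
  have e : bar (bar Ψ) = Ψ := Subtype.ext (compl_compl Ψ.1)
  have h' : C.IsSubCorner K (bar (bar Ψ)) (conjugate σ) := by
    rw [e]
    exact h
  have := isSubCorner_conjugate_of_isSubCorner_bar C h'
  rwa [involutive_conjugate K σ] at this

/-- **Full conjugation of the corner LABELS is a symmetry of `IsSubCorner`: `C.IsSubCorner K Ψ̄ σ̄ ↔ C.IsSubCorner K Ψ σ`** — so the
conjugate-labelled seesaw context `c̄ := ⟨c.K, bar ∘ c.Ψ, conj ∘ c.σ, c.D⟩` (W-B″, pin-a's `SeesawCtx.conjLabel`) has EXACTLY the same sub-corner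
records as `c` at every slot: relabelling cannot change which CM records serve the corner. [folklore] -/
theorem isSubCorner_bar_conjugate_iff (C : LiuCMSide) {K : CMField} (Ψ : CMType K) (σ : (K : Type) →+* ℂ) :
    C.IsSubCorner K (bar Ψ) (conjugate σ) ↔ C.IsSubCorner K Ψ σ := by
  rw [isSubCorner_bar_iff_conjugate, involutive_conjugate K σ]

/-! ## §2 Along a sub-corner the corner embedding and the record's eigen-embedding have the same position -/

/-- **`σ ∈ Ψ ↔ C.τ ∈ C.ΦA` along any sub-corner** (`σ ∘ e₁ = τ ∘ e₂` read against the common type `Φ'`). [folklore] -/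
theorem mem_iff_tau_mem_of_isSubCorner (C : LiuCMSide) {K : CMField} {Ψ : CMType K} {σ : (K : Type) →+* ℂ}
    (h : C.IsSubCorner K Ψ σ) : σ ∈ Ψ.1 ↔ C.τ ∈ C.ΦA.1 := by
  obtain ⟨M', Φ', e₁, e₂, hΨ, hΦA, hστ⟩ := h
  rw [hΨ σ, hΦA C.τ, hστ]

/-! ## §3 With the orientation lemmas: which corners `adm`- and `adm′`-records serve at a `PhiMu` line -/

variable {L : CMField} {ι₁ : (L : Type) →+* ℂ}

/-- An `ι₁`-admissible record for `Φ` with `ι₁ ∈ Φ` (the dictionary's `adm` at a `PhiMu` line; K2: its class is `(1,0)`) is a sub-corner only of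
corners whose embedding lies IN the corner type. [folklore] -/
theorem mem_of_isSubCorner_of_isReflexOfTypeG [IsGalois ℚ L] (d : LiuCMSide) (Φ : CMType L) (hd : d.IsReflexOfTypeG ι₁ Φ)
    (hι : ι₁ ∈ Φ.1) {K : CMField} {Ψ : CMType K} {σ : (K : Type) →+* ℂ} (h : d.IsSubCorner K Ψ σ) : σ ∈ Ψ.1 :=
  (mem_iff_tau_mem_of_isSubCorner d h).2
    (Summit.HodgeConjecture.CorCM.D2Bridge.tau_mem_cmType_of_isReflexOfType ι₁ d Φ (hd ‹IsGalois ℚ L›) hι)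

/-- **An `ῑ₁`-admissible record for `Φ` with `ι₁ ∈ Φ` (the PRIMED `adm′` at a `PhiMu` line; K3: its class is `(0,1)`) is a sub-corner only of
corners whose embedding lies OUTSIDE the corner type** — so never of the served corner `(c.K, c.Ψ i, c.σ)` (`c.σ ∈ c.Ψ i`) nor of its full
conjugate `(c.K, bar (c.Ψ i), conj ∘ c.σ)`. [folklore] -/
theorem not_mem_of_isSubCorner_of_isReflexOfTypeG_starRingEnd_comp [IsGalois ℚ L] (d : LiuCMSide) (Φ : CMType L)
    (hd : d.IsReflexOfTypeG ((starRingEnd ℂ).comp ι₁) Φ) (hι : ι₁ ∈ Φ.1) {K : CMField} {Ψ : CMType K} {σ : (K : Type) →+* ℂ}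
    (h : d.IsSubCorner K Ψ σ) : σ ∉ Ψ.1 :=
  fun hσ => Summit.HodgeConjecture.CorCM.D2Bridge.tau_notMem_cmType_of_isReflexOfType_starRingEnd_comp ι₁ d Φ (hd ‹IsGalois ℚ L›) hι
    ((mem_iff_tau_mem_of_isSubCorner d h).1 hσ)

/-- Packaged for the seesaw context of the junction: at a served corner (`hmem : c.σ ∈ (c.Ψ i).1`, e.g. `GoodCtx.mem`), NO `adm′`-record of a
type `Φ ∋ ι₁` is a sub-corner of `(c.K, c.Ψ i, c.σ)`. [folklore] -/
theorem not_isSubCorner_of_isReflexOfTypeG_starRingEnd_comp [IsGalois ℚ L] (d : LiuCMSide) (Φ : CMType L)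
    (hd : d.IsReflexOfTypeG ((starRingEnd ℂ).comp ι₁) Φ) (hι : ι₁ ∈ Φ.1) {c : SeesawCtx L} {i : Fin 4} (hmem : c.σ ∈ (c.Ψ i).1) :
    ¬ d.IsSubCorner c.K (c.Ψ i) c.σ :=
  fun h => not_mem_of_isSubCorner_of_isReflexOfTypeG_starRingEnd_comp d Φ hd hι h hmem

/-- … nor of the fully conjugated corner `(c.K, bar (c.Ψ i), conj ∘ c.σ)` (`σ̄ ∈ Ψ̄` since `σ ∈ Ψ`). [folklore] -/
theorem not_isSubCorner_bar_conjugate_of_isReflexOfTypeG_starRingEnd_comp [IsGalois ℚ L] (d : LiuCMSide) (Φ : CMType L)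
    (hd : d.IsReflexOfTypeG ((starRingEnd ℂ).comp ι₁) Φ) (hι : ι₁ ∈ Φ.1) {c : SeesawCtx L} {i : Fin 4} (hmem : c.σ ∈ (c.Ψ i).1) :
    ¬ d.IsSubCorner c.K (bar (c.Ψ i)) (conjugate c.σ) :=
  fun h => not_mem_of_isSubCorner_of_isReflexOfTypeG_starRingEnd_comp d Φ hd hι h
    ((mem_bar_iff (c.Ψ i) (conjugate c.σ)).2 fun hc => (conjugate_mem_iff_notMem (c.Ψ i) c.σ).1 hc hmem)

/-! ## §4 Refutation: the primed junction's clause 2 (`hsub`) is unsatisfiable at a served `PhiMu` slot — under either labelling -/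

open Literature.NumberTheory.Automorphic.PicardCM (CMAbelianVarietyRealised)

/-- **REFUTED: «every `adm′`-record is a sub-corner of the served corner».**  At a slot with `c.σ ∈ c.Ψ i` and a type `Φ ∋ ι₁`, the clause
`∀ d, d.IsReflexOfTypeG ῑ₁ Φ → d.IsSubCorner c.K (c.Ψ i) c.σ` (the `hsub` input of #H15∕R2BGal′ for the primed `adm′`) is FALSE: own-htheta's
reflex record `ofReflex ῑ₁ hCM Φ` is `ῑ₁`-admissible (witness of `exists_isReflexOfTypeG_α_ne_zero ῑ₁`) and, by (F4), no such record is a sub-corner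
there. [folklore] -/
theorem not_forall_isReflexOfTypeG_starRingEnd_comp_isSubCorner [IsGalois ℚ L] (hCM : CMAbelianVarietyRealised) (Φ : CMType L)
    (hι : ι₁ ∈ Φ.1) {c : SeesawCtx L} {i : Fin 4} (hmem : c.σ ∈ (c.Ψ i).1) :
    ¬ ∀ d : LiuCMSide, d.IsReflexOfTypeG ((starRingEnd ℂ).comp ι₁) Φ → d.IsSubCorner c.K (c.Ψ i) c.σ := by
  intro h
  obtain ⟨d, hd, -⟩ := HodgeCM.Model.LiuCMSide.exists_isReflexOfTypeG_α_ne_zero ((starRingEnd ℂ).comp ι₁) hCM Φ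
  exact not_isSubCorner_of_isReflexOfTypeG_starRingEnd_comp d Φ hd hι hmem (h d hd)

/-- … and the same clause at the conjugate-labelled context `c̄ = ⟨c.K, bar ∘ c.Ψ, conj ∘ c.σ, c.D⟩` (W-B″) is FALSE too
(`isSubCorner_bar_conjugate_iff`). [folklore] -/
theorem not_forall_isReflexOfTypeG_starRingEnd_comp_isSubCorner_bar_conjugate [IsGalois ℚ L] (hCM : CMAbelianVarietyRealised)
    (Φ : CMType L) (hι : ι₁ ∈ Φ.1) {c : SeesawCtx L} {i : Fin 4} (hmem : c.σ ∈ (c.Ψ i).1) :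
    ¬ ∀ d : LiuCMSide, d.IsReflexOfTypeG ((starRingEnd ℂ).comp ι₁) Φ → d.IsSubCorner c.K (bar (c.Ψ i)) (conjugate c.σ) := by
  intro h
  exact not_forall_isReflexOfTypeG_starRingEnd_comp_isSubCorner hCM Φ hι hmem
    fun d hd => (isSubCorner_bar_conjugate_iff d (c.Ψ i) c.σ).1 (h d hd)

end HodgeCM.Model.Rekey

end
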